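import Literature.Analysis.FluidPDE.LerayHopfGalileanTorusTools
import Literature.Analysis.FluidPDE.LongTimeAverageSubadditive
import HarnessLib

/-!
# Galilean change of frame on the flat torus — long-time means of a global Leray–Hopf solution

Analysis/FluidPDE support file (all proved).  Let `u` be a GLOBAL Leray–Hopf solution on `T^d` driven by a steady
smooth mean-zero force `f`, and let `v t y := u t (y + [tV]) − V`, `[tV] := proj (t • V)`, be its velocity in the
frame moving with the constant velocity `V`, driven by the swept force `g t y := f (y + [tV])`.  Slice-wise
(`LerayHopfGalileanTorusTools`) the power input is unchanged, `∫⟪g t, v t⟫ = ∫⟪f, u t⟫` (the force has zero mean),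
the dissipation is unchanged, `‖∇(v t)‖₂² = ‖∇(u t)‖₂²`, and the energy satisfies `∫‖v t‖² ≤ 2∫‖u t‖² + 2‖V‖²`;
hence for the long-time (limsup-Cesàro) means of the zeroth-law vocabulary

* `Torus.IsGlobalLerayHopf.longTimeAvgSup_work_galilean` — `⟨(g, v)⟩ = ⟨(f, u)⟩`;
* `Torus.IsGlobalLerayHopf.meanDissipation_galilean` — `meanDissipation ν v = meanDissipation ν u`;
* `Torus.IsGlobalLerayHopf.meanEnergy_galilean_le` — `meanEnergy v ≤ 2·meanEnergy u + 2‖V‖²` (`ν > 0`: the running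
  energy means of `u` are bounded, `Torus.IsGlobalLerayHopf.timeMean_norm_sq_le`).

All statements only involve times `t > 0`, so they are insensitive to the normalisation of the time-zero slice
(`longTimeAvgSup_congr_of_eqOn_Ioi`, `meanEnergy_congr_of_eqOn_Ioi`, `meanDissipation_congr_of_eqOn_Ioi`).
Standard (Frisch, *Turbulence* (1995) §2.2; Doering–Foias, J. Fluid Mech. 467 (2002) §2).
-/

noncomputable section

open MeasureTheory Set Filter Topology
open scoped InnerProductSpace RealInnerProductSpace ENNReal NNReal

namespace Literature.Analysis.FluidPDE

/-! ### Long-time means only see positive times -/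

/-- Two observables that agree on `(0, ∞)` have the same running means for `T > 0`, hence the same limsup
long-time average. [folklore] -/
theorem longTimeAvgSup_congr_of_eqOn_Ioi {g g' : ℝ → ℝ} (h : ∀ t, 0 < t → g t = g' t) :
    longTimeAvgSup g = longTimeAvgSup g' := by
  unfold longTimeAvgSup
  refine limsup_congr ?_
  filter_upwards [eventually_gt_atTop (0 : ℝ)] with T hT
  unfold timeMean
  rw [intervalIntegral.integral_of_le hT.le, intervalIntegral.integral_of_le hT.le,
    setIntegral_congr_fun measurableSet_Ioc fun t ht => h t ht.1]

/-- The mean energy only sees positive times. [folklore] -/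
theorem meanEnergy_congr_of_eqOn_Ioi {d : Type*} [Fintype d] {u v : ℝ → UnitAddTorus d → EuclideanSpace ℝ d}
    (h : ∀ t, 0 < t → v t = u t) : meanEnergy v = meanEnergy u := by
  rw [meanEnergy_eq_longTimeAvgSup, meanEnergy_eq_longTimeAvgSup]
  exact longTimeAvgSup_congr_of_eqOn_Ioi fun t ht => by rw [h t ht]

/-- The mean dissipation only sees positive times. [folklore] -/
theorem meanDissipation_congr_of_eqOn_Ioi {d : Type*} [Fintype d] {ν : ℝ}
    {u v : ℝ → UnitAddTorus d → EuclideanSpace ℝ d} (h : ∀ t, 0 < t → v t = u t) :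
    meanDissipation ν v = meanDissipation ν u :=
  longTimeAvgSup_congr_of_eqOn_Ioi fun t ht => by rw [h t ht]

namespace Torus

open Literature.Analysis.FunctionSpaces Literature.Analysis.FunctionSpaces.Torus

variable {d : Type*} [Fintype d] [DecidableEq d]
variable {ν : ℝ} {f : UnitAddTorus d → EuclideanSpace ℝ d} {u₀ : UnitAddTorus d → EuclideanSpace ℝ d}
  {u : ℝ → UnitAddTorus d → EuclideanSpace ℝ d}

/-! ### Slice identities along a global Leray–Hopf solution -/

/-- **Power input is frame independent** (zero-mean force): `∫⟪f (· + a), u t (· + a) − V⟫ = ∫⟪f, u t⟫` for every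
`t ≥ 0`. [folklore] -/
theorem IsGlobalLerayHopf.integral_inner_galilean (hu : IsGlobalLerayHopf ν (fun _ => f) u₀ u)
    (hf : IsSmooth f) (hf0 : HasZeroMean f) (V : EuclideanSpace ℝ d) {t : ℝ} (ht : 0 ≤ t) (a : UnitAddTorus d) :
    ∫ y, ⟪f (y + a), u t (y + a) - V⟫ = ∫ x, ⟪f x, u t x⟫ := by
  have hui : Integrable (u t) volume := (hu.memLp_two ht).integrable one_le_two
  have i1 : Integrable (fun x => ⟪f x, u t x⟫) volume :=
    (integrable_inner_of_continuous hui hf.continuous).congr (ae_of_all _ fun x => real_inner_comm _ _)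
  have hc : (fun x => ⟪f x, V⟫) = fun x => ⟪V, f x⟫ := funext fun x => real_inner_comm _ _
  have hsplit : (fun y => ⟪f (y + a), u t (y + a) - V⟫) =
      fun y => (fun x => ⟪f x, u t x⟫ - ⟪f x, V⟫) (y + a) := by
    funext y; simp only [inner_sub_right]
  rw [hsplit, integral_add_right_eq_self (fun x => ⟪f x, u t x⟫ - ⟪f x, V⟫) a,
    integral_sub i1 (hf.integrable.inner_const V), hc, integral_inner hf.integrable V]
  rw [show (∫ x, f x) = 0 from hf0, inner_zero_right, sub_zero]

/-- **Dissipation is frame independent**: `‖∇(u t (· + a) − V)‖₂² = ‖∇(u t)‖₂²` for every `t ≥ 0`. [folklore] -/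
theorem IsGlobalLerayHopf.eGradNormSq_galilean (hu : IsGlobalLerayHopf ν (fun _ => f) u₀ u)
    (V : EuclideanSpace ℝ d) {t : ℝ} (ht : 0 ≤ t) (a : UnitAddTorus d) :
    eGradNormSq (fun y => u t (y + a) - V) = eGradNormSq (u t) :=
  eGradNormSq_comp_add_right_sub_const ((hu.memLp_two ht).integrable one_le_two) a V

/-- **Energy in the moving frame**: `∫‖u t (· + a) − V‖² ≤ 2∫‖u t‖² + 2‖V‖²` for every `t ≥ 0`. [folklore] -/
theorem IsGlobalLerayHopf.integral_norm_sq_galilean_le (hu : IsGlobalLerayHopf ν (fun _ => f) u₀ u)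
    (V : EuclideanSpace ℝ d) {t : ℝ} (ht : 0 ≤ t) (a : UnitAddTorus d) :
    ∫ y, ‖u t (y + a) - V‖ ^ 2 ≤ 2 * (∫ x, ‖u t x‖ ^ 2) + 2 * ‖V‖ ^ 2 := by
  have h2 := hu.memLp_two ht
  have hsq : Integrable (fun x => ‖u t x‖ ^ 2) volume := h2.integrable_norm_pow two_ne_zero
  have hv : Integrable (fun y => ‖u t (y + a) - V‖ ^ 2) volume :=
    (memLp_comp_add_right_sub_const h2 a V).integrable_norm_pow two_ne_zero
  have hpt : ∀ y, ‖u t (y + a) - V‖ ^ 2 ≤ 2 * ‖u t (y + a)‖ ^ 2 + 2 * ‖V‖ ^ 2 := by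
    intro y
    have h0 : ‖u t (y + a) - V‖ ^ 2 ≤ (‖u t (y + a)‖ + ‖V‖) ^ 2 :=
      pow_le_pow_left₀ (norm_nonneg _) (norm_sub_le _ _) 2
    nlinarith [h0, sq_nonneg (‖u t (y + a)‖ - ‖V‖)]
  calc ∫ y, ‖u t (y + a) - V‖ ^ 2 ≤ ∫ y, (2 * ‖u t (y + a)‖ ^ 2 + 2 * ‖V‖ ^ 2) :=
        integral_mono hv (((hsq.comp_add_right a).const_mul 2).add (integrable_const _)) hpt
    _ = 2 * (∫ y, ‖u t (y + a)‖ ^ 2) + 2 * ‖V‖ ^ 2 := by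
        rw [integral_add ((hsq.comp_add_right a).const_mul 2) (integrable_const _), integral_const_mul,
          integral_const, probReal_univ, one_smul]
    _ = 2 * (∫ x, ‖u t x‖ ^ 2) + 2 * ‖V‖ ^ 2 := by
        rw [integral_add_right_eq_self (fun x => ‖u t x‖ ^ 2) a]

/-! ### Long-time means in the moving frame -/

/-- **The mean power input is frame independent**:
`⟨∫⟪f (· + [tV]), u t (· + [tV]) − V⟫⟩ = ⟨∫⟪f, u t⟫⟩` (limsup-Cesàro means). [folklore] -/
theorem IsGlobalLerayHopf.longTimeAvgSup_work_galilean (hu : IsGlobalLerayHopf ν (fun _ => f) u₀ u)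
    (hf : IsSmooth f) (hf0 : HasZeroMean f) (V : EuclideanSpace ℝ d) :
    longTimeAvgSup (fun t => ∫ y, ⟪f (y + proj (t • V)), u t (y + proj (t • V)) - V⟫) =
      longTimeAvgSup (fun t => ∫ x, ⟪f x, u t x⟫) :=
  longTimeAvgSup_congr_of_eqOn_Ioi fun _ ht => hu.integral_inner_galilean hf hf0 V ht.le _

/-- **The mean dissipation is frame independent**: `meanDissipation ν v = meanDissipation ν u` for the velocity
`v t = u t (· + [tV]) − V` in the moving frame. [folklore] -/
theorem IsGlobalLerayHopf.meanDissipation_galilean (hu : IsGlobalLerayHopf ν (fun _ => f) u₀ u)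
    (V : EuclideanSpace ℝ d) :
    meanDissipation ν (fun t y => u t (y + proj (t • V)) - V) = meanDissipation ν u :=
  longTimeAvgSup_congr_of_eqOn_Ioi fun _ ht => by rw [hu.eGradNormSq_galilean V ht.le]

/-- **Mean energy in the moving frame**: `meanEnergy v ≤ 2·meanEnergy u + 2‖V‖²` for `v t = u t (· + [tV]) − V`, along
a global Leray–Hopf solution driven by a steady smooth mean-zero force at `ν > 0` (whose running energy means are
bounded, `timeMean_norm_sq_le`, so the limsups are honest). [folklore] -/
theorem IsGlobalLerayHopf.meanEnergy_galilean_le (hν : 0 < ν) (hu : IsGlobalLerayHopf ν (fun _ => f) u₀ u)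
    (hf : IsSmooth f) (hf0 : HasZeroMean f) (V : EuclideanSpace ℝ d) :
    meanEnergy (fun t y => u t (y + proj (t • V)) - V) ≤ 2 * meanEnergy u + 2 * ‖V‖ ^ 2 := by
  rw [meanEnergy_eq_longTimeAvgSup, meanEnergy_eq_longTimeAvgSup, ← longTimeAvgSup_const_mul two_pos.le]
  set E : ℝ → ℝ := fun t => ∫ x, ‖u t x‖ ^ 2 with hE
  have hE0 : ∀ t, 0 ≤ 2 * E t := fun t => mul_nonneg two_pos.le (integral_nonneg fun _ => sq_nonneg _)
  have hfi : ∀ T, 0 < T → IntegrableOn (fun t => 2 * E t) (Ioc 0 T) := fun T hT =>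
    (hu.integrableOn_integral_norm_sq hT).const_mul 2
  have hgi : ∀ T, 0 < T → IntegrableOn (fun _ : ℝ => 2 * ‖V‖ ^ 2) (Ioc 0 T) := fun T _ =>
    integrableOn_const (hs := measure_Ioc_lt_top.ne)
  -- bounded running means of the energy (Doering–Foias a priori bound)
  have hEb : IsBoundedUnder (· ≤ ·) atTop (timeMean E) := by
    refine ⟨kineticEnergy u₀ / (2 * Real.pi ^ 2 * ν) +
      (2 * ‖∫ x, u 1 x‖ ^ 2 + (∫ x, ‖f x‖ ^ 2) / (16 * Real.pi ^ 4 * ν ^ 2)), ?_⟩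
    rw [eventually_map]
    filter_upwards [eventually_ge_atTop (1 : ℝ)] with T hT
    exact hu.timeMean_norm_sq_le hν hf hf0 hT
  have hfb : IsBoundedUnder (· ≤ ·) atTop (timeMean fun t => 2 * E t) :=
    isBoundedUnder_timeMean_const_mul two_pos.le hEb
  have hconst : ∀ T, 0 < T → timeMean (fun _ : ℝ => 2 * ‖V‖ ^ 2) T = 2 * ‖V‖ ^ 2 := fun T hT => by
    unfold timeMean
    rw [intervalIntegral.integral_const, smul_eq_mul, sub_zero, ← mul_assoc, inv_mul_cancel₀ hT.ne', one_mul]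
  have hgb : IsBoundedUnder (· ≤ ·) atTop (timeMean fun _ : ℝ => 2 * ‖V‖ ^ 2) := by
    refine ⟨2 * ‖V‖ ^ 2, ?_⟩
    rw [eventually_map]
    exact (eventually_gt_atTop (0 : ℝ)).mono fun T hT => (hconst T hT).le
  have hle : ∀ t, 0 < t → (∫ y, ‖u t (y + proj (t • V)) - V‖ ^ 2) ≤ 2 * E t + 2 * ‖V‖ ^ 2 :=
    fun t ht => hu.integral_norm_sq_galilean_le V ht.le _
  have h := longTimeAvgSup_le_add_of_le_add (fun t => integral_nonneg fun _ => sq_nonneg _) hE0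
    (fun _ => by positivity) hfi hgi hfb hgb hle
  have hK : longTimeAvgSup (fun _ : ℝ => 2 * ‖V‖ ^ 2) ≤ 2 * ‖V‖ ^ 2 :=
    longTimeAvgSup_le_const (fun _ => by positivity) fun _ _ => le_rfl
  linarith

end Torus

end Literature.Analysis.FluidPDE
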